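import Literature.MathematicalPhysics.QuantumFieldTheory.Balaban1983to89.Node00.HistoryTermDatum214
import Literature.MathematicalPhysics.QuantumFieldTheory.Balaban1983to89.B13Lemma3TorusPrimitivePoly

/-!
# NODE 00 (YM-PLAN Track A) — W1 = [II] §2 (2.13)–(2.14), STOREY 8: THE LOCATED (2.26) INPUTS OF ONE TERM OF THE DATUM AS ONE RECORD
# (`TermDatum214.Inputs226` ∕ `PrimitiveInputs226 : Prop`, and the `hΨσ ∕ hΨτ`-free variant at print's per-domain τ-radii `Inputs226Holo` ∕
# `PrimitiveInputs226Holo`) + THE (2.26) SOCKETS KEYED ON THEM (`norm_TF_le_weight_of_inputs226[Holo]`)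

NODE 00 DEFINER MODULE (seat `pub-ymgap-node00-def-W1`, generation 7, 2026-08-27).  APPEND-ONLY: a NEW importing module; storey 7
`Node00/HistoryTermDatum214` (`TermDatum214`, `TF`, `norm_TF_le_weight_of_primitives`), `B13Lemma3TorusPrimitive` and `B13Lemma3TorusPrimitivePoly`
untouched and CONSUMED BY NAME.  [II] = [Balaban1988RG2Cluster] T. Bałaban, *Renormalization group approach to lattice gauge field theories. II.
Cluster expansions*, Commun. Math. Phys. **116** (1988) 1–22.

WHY (DESIGN-INPUT of node N22's seat, INBOX 2026-08-27T05:30:42Z, on storey 7).  Storey 7's socket `TermDatum214.norm_TF_le_weight_of_primitives`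
(= the torus (2.26) joiner of record `B13Lemma3TorusPrimitive.h226_torus_of_primitives` at the datum, kernel-keyed) displays, after the term's pins
`(Z t s old φ)`, some fifty LOCATED INPUT binders — the τ-radii conditions (2.18), the analyticity domains, separate analyticity of the (2.14)
X-integral, symmetry ∕ `Re ≻ 0` of `A(σ,u)`, the (2.22) shape of `χχᶜ`, the (2.20) shape of `𝐕`, the column fibre bound, the seven primitive kernel
letters (L17a)∕(L16a), the numerics (2.24)–(2.26) and the constant matching of p. 17.  The Summit-side per-term schemas at `TF := 𝔇.TF` (N22's
(S-226-T)∕(S-last-T) on a coupling strip, N18's (T-226)) would each RESTATE that list under their own quantifiers («for all z in the strip, at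
old := cv z …»).  THIS STOREY bundles the list ONCE, W1-side: a Type-valued record `𝔇.Inputs226 Z t s old φ a a₅` (data fields = the two
parameter regions `Uσ Uτ`, the quadratic minorant `qP` of (2.22) and the real letters `γ₂ rP a₂₀ w κ κ′ κ″ θ θ_E θ_Γ θ_C K_G K_Γ K_Cs K₀ c_E g`;
Prop fields = storey 7's hypotheses verbatim), its propositional shadow `𝔇.PrimitiveInputs226 Z t s old φ a a₅ : Prop := Nonempty (…)` — so a
schema line reads «`∀ z ∈ D, 𝔇.PrimitiveInputs226 Z t s (cv z) φ a a₅`» —, and the socket `norm_TF_le_weight_of_inputs226 : 1 ≤ c.κ₁ → c.α₆ ≠ 0 →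
𝔇.PrimitiveInputs226 Z t s old φ a a₅ → ‖𝔇.TF Z t s old φ‖ ≤ weight L M c Z a t · exp(a₅|Z|)` (storey 7's socket, field by field).  The indices
kept outside the record are exactly the letters of the CONCLUSION (`a`, `a₅`; `c` is the datum's) and the two global numerals `1 ≤ κ₁`, `α₆ ≠ 0`.

THE `hΨσ ∕ hΨτ`-FREE VARIANT (node N10's re-issued currency).  N10's torus chain now consumes (2.26) through the cell-gaps joiner
`B13Lemma3TorusPrimitivePoly.h226_torus_of_primitives_holo_polyτ`: both separate-analyticity slots DERIVED from entrywise σ-holomorphy of the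
kernels `A(σ,u)`, `G(σ,u)` on an open σ-polydisc, measurability of `χ_{k,Y₀}`, `χᶜ_{k,P}`, `𝐕_k(Y,·)`, and (2.20) on the open PER-DOMAIN τ-region
`Π_Y Uτ(Y)` (print's radii (2.18), torus-uniform); the σ-letters on the open polydisc.  §2 types that joiner at the datum
(`norm_TF_le_weight_of_primitives_holo`, kernel-keyed exactly as storey 7's socket, with the ESTIMATE's constants record `c` a binder — the datum's
own record `c₀` only keys its kernel tower, `TF` being `c`-free — so kernels may live on a bigger polydisc than the estimate's, p. 15), and §3
bundles ITS located inputs the same way: `𝔇.Inputs226Holo c Z t s old φ a a₅`, `𝔇.PrimitiveInputs226Holo c Z t s old φ a a₅ : Prop`,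
`norm_TF_le_weight_of_inputs226Holo`.  Holders of the two named (2.16)-level records `B13PrimitiveKernels216.Localisation17a ∕ Differences216`
(NODE A's capstones `B13TermWalkData.localisation17a_of_termWalkData` ∕ `differences216_of_termWalkData` at `u := 𝔇.uOf Z t φ`) fill the seven
letter fields by the projections `h17.hG h17.hΓ₀ h17.hCs h17.hC216 h16.hdΓ h16.hdC h16.hdE` (`𝔇.A Z t φ σ` is `(𝒦 Z t).A2 σ (uOf φ)` by `rfl`;
in the `hΨ`-free record the σ-letters are restricted from the records' closed polydisc to `Uσ ⊆ closedBall 0 (e^{κ₁⁺})`, as in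
`B13PrimitiveKernels216Holo.h226_torus_of_kernelBounds_holo`).

HONEST FRAMING: two records that are LISTS OF HYPOTHESES (nothing asserted: a record is inhabited only by supplying every located input), their
`Nonempty` shadows, their weakening in the weight letters (`weaken`: antitone in `a`, monotone in `a₅`), and three kernel-checked applications of
landed generic theorems at the datum's pins; nothing of Bałaban's asserted or constructed; N18 ∕ N22 ∕ N10 ∕ NODE A NOT discharged; K3‴ untouched;
counts unmoved; one finite 𝕋⁴ programme at fixed ε, Bałaban as printed — NOT continuum ∕ ℝ⁴ ∕ infinite volume ∕ OS ∕ mass gap ∕ Clay.  No `sorry`,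
no `axiom`, no `instance`, no `notation`.

References (TYPES and page anchors only): [II] (2.14)–(2.15) p.15, (2.16)–(2.22) p.16, (2.23)–(2.26) p.17, Lemma 2 p.11, p.13.
-/

open scoped BigOperators

noncomputable section

namespace Literature.MathematicalPhysics.QuantumFieldTheory.Balaban1983to89.Node00

open Metric Set Matrix
open Literature.MathematicalPhysics.QuantumFieldTheory.Balaban1983to89
open Step B14.Eq213MaximalDomains TreeLengthTorus T4Continuum Sect2
open Literature.MathematicalPhysics.QuantumFieldTheory.Balaban1983to89.B13Lemma3TorusData (TBond)
open Literature.MathematicalPhysics.QuantumFieldTheory.Balaban1983to89.B13Lemma3TorusTerms (terms weight Z0)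
open Literature.MathematicalPhysics.QuantumFieldTheory.Balaban1983to89.B13Term214 (term214 SepHolOn core214 F214)
open Literature.MathematicalPhysics.QuantumFieldTheory.Balaban1983to89.B13Bound143 (invTau)
open Literature.MathematicalPhysics.QuantumFieldTheory.Balaban1983to89.B9Thm37GlueTorus (tdist1)
open Literature.MathematicalPhysics.QuantumFieldTheory.Balaban1983to89.B5TorusCover (UT)
open Literature.MathematicalPhysics.QuantumFieldTheory.Balaban1983to89.B13Lemma3TorusPrimitivePoly (h226_torus_of_primitives_holo_polyτ)

namespace W1

namespace TermDatum214

/-! ## §1  The located (2.26) inputs of one term of the datum as ONE record, and storey 7's socket keyed on it -/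

section Inputs

variable {c : B13.Consts} {P : Params} {𝔸 : Type*} {M k L : ℕ} [NeZero L] (𝔇 : TermDatum214 c P 𝔸 M k L)

open Classical in
/-- **THE LOCATED (2.26) INPUTS OF THE TERM `t = (𝐃, P)` OF `H(Z)` AT THE COUPLING `s`, THE HISTORY `old` AND THE BACKGROUND `φ`, FOR THE
WEIGHT LETTERS `(a, a₅)`** — the binders of storey 7's socket `norm_TF_le_weight_of_primitives` after the pins `(Z t s old φ)`, verbatim, as the
fields of one Type-valued record (data: the σ- and τ-regions `Uσ Uτ`, the quadratic minorant `qP` of (2.22), the real letters of (2.20)∕(2.22),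
the rates `κ > κ′ > κ″ > 0`, the kernel constants and the (2.24)–(2.25) letters `c_E, g`; propositions: the τ-radii conditions (2.18), the domains,
separate analyticity of the X-integral (`hΨσ ∕ hΨτ`), symmetry ∕ `Re ≻ 0` of `A(σ,u)`, the (2.22)∕(2.20) shapes, the column fibre bound, the seven
primitive kernel letters (L17a)∕(L16a) at the configuration, the numerics and the constant matching of p. 17).  A LIST OF HYPOTHESES — inhabited
only by supplying every located input; nothing asserted. [cite: Balaban1988RG2Cluster, (2.14)-(2.15) p.15, (2.16)-(2.22) p.16, (2.23)-(2.26) p.17] -/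
structure Inputs226 (Z : (domSys P M (k + 1)).Dom) (t : TermLabel P M k L) (s : ℂ) (old : OlderTerms P 𝔸 M k) (φ : CPair P 𝔸)
    (a a₅ : ℝ) where
  hpos : ∀ Y : TDom P.d (L * domCount P M (k + 1)), 0 < invTau c ((tsys P.d (L * domCount P M (k + 1))).dj Y)
  hhalf : ∀ Y : TDom P.d (L * domCount P M (k + 1)), invTau c ((tsys P.d (L * domCount P M (k + 1))).dj Y) ≤ 1 / 2
  Uσ : Set ℂ
  Uτ : Set ℂ
  hUσ : IsOpen Uσ
  hUτ : IsOpen Uτ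
  hUexp : closedBall (0 : ℂ) (Real.exp c.κ₁) ⊆ Uσ
  hUtau : ∀ Y : TDom P.d (L * domCount P M (k + 1)), closedBall (0 : ℂ) ((invTau c ((tsys P.d (L * domCount P M (k + 1))).dj Y))⁻¹) ⊆ Uτ
  hr : 0 < 𝔇.r
  hr' : 𝔇.r ≤ Real.exp c.κ₁ - 1
  hsubτ : ∀ x ∈ Set.uIcc (0 : ℝ) 1, closedBall (x : ℂ) 𝔇.r ⊆ Uτ
  -- the last line at the coupling: signs of χ, χᶜ
  hχ0 : ∀ B, 0 ≤ 𝔇.chiY₀ Z t s B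
  hχc0 : ∀ B, 0 ≤ 𝔇.chicP Z t s B
  -- separate analyticity of the X-integral
  hΨσ : ∀ τ : TDom P.d (L * domCount P M (k + 1)) → ℂ, (∀ j, τ j ∈ Uτ) → SepHolOn Uσ (fun σ => 𝔇.core Z t s old φ σ τ)
  hΨτ : ∀ σ : TPt P.d (domCount P M (k + 1)) → ℂ, (∀ j, σ j ∈ Uσ) → SepHolOn Uτ (fun τ => 𝔇.core Z t s old φ σ τ)
  -- NODE A: symmetry and `Re ≻ 0` of the precision at (σ, u)
  hAs : ∀ σ : TPt P.d (domCount P M (k + 1)) → ℂ, (∀ j, ‖σ j‖ ≤ Real.exp c.κ₁) → (𝔇.A Z t φ σ).IsSymm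
  hA : ∀ σ : TPt P.d (domCount P M (k + 1)) → ℂ, (∀ j, ‖σ j‖ ≤ Real.exp c.κ₁) → ((𝔇.A Z t φ σ).map Complex.re).PosDef
  -- the (2.22) and (2.20) shapes
  γ₂ : ℝ
  rP : ℝ
  a₂₀ : ℝ
  w : ℝ
  qP : ((𝔇.𝒦 Z t).Λ → ℝ) → ℝ
  h222 : ∀ B, 𝔇.chiY₀ Z t s B * 𝔇.chicP Z t s B ≤ Real.exp (-(γ₂ / 2 * rP ^ 2 * (t.2.card : ℕ)) + γ₂ / 2 * qP B)
  hγ₂ : 0 ≤ γ₂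
  hqP : ∀ B, qP B ≤ B ⬝ᵥ B
  h220R : ∀ B, ∑ Y ∈ t.1, (invTau c ((tsys P.d (L * domCount P M (k + 1))).dj Y))⁻¹ * ‖𝔇.𝒱 Z t s old φ Y B‖ ≤ a₂₀ / 2 * (B ⬝ᵥ B) + w
  ha0 : 0 ≤ a₂₀
  -- the column fibre bound (rows: the kernel record's `hfib`)
  hfibN : ∀ x : UT 𝔇.Nf, (Finset.univ.filter fun j => (𝔇.𝒦 Z t).locN j = x).card ≤ (𝔇.𝒦 Z t).m
  -- rates and constants
  kap : ℝ
  kap' : ℝ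
  kap'' : ℝ
  θ : ℝ
  θE : ℝ
  θΓ : ℝ
  θC : ℝ
  KG : ℝ
  KΓ : ℝ
  KCs : ℝ
  K₀ : ℝ
  hkap'' : 0 < kap''
  h1 : kap'' < kap'
  h2 : kap' < kap
  hθE : 0 ≤ θE
  hθΓ : 0 ≤ θΓ
  hθC : 0 ≤ θC
  hKG : 0 ≤ KG
  hKΓ : 0 ≤ KΓ
  hKCs : 0 ≤ KCs
  hK₀ : 0 ≤ K₀
  hθEle : θE ≤ θ
  hθΓle : θΓ ≤ θ
  hθR1le : ((𝔇.𝒦 Z t).m * (1 + 2 / (kap - kap')) ^ 𝔇.ν) * ((𝔇.𝒦 Z t).m * (1 + 2 / (kap' - kap'')) ^ 𝔇.ν)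
      * (θΓ * KCs * KG + KΓ * θC * KG + KΓ * K₀ * θΓ) ≤ θ
  -- (L17a) for the kernels at the configuration, in the torus distance
  hG : ∀ σ : TPt P.d (domCount P M (k + 1)) → ℂ, (∀ j, ‖σ j‖ ≤ Real.exp c.κ₁) →
      ∀ b j, ‖(𝔇.𝒦 Z t).G2 σ (𝔇.uOf Z t φ) b j‖ ≤ KG * Real.exp (-(kap * tdist1 𝔇.Nf ((𝔇.𝒦 Z t).locΛ b) ((𝔇.𝒦 Z t).locN j)))
  hΓ₀ : ∀ b j, ‖(𝔇.𝒦 Z t).Γ₀ b j‖ ≤ KΓ * Real.exp (-(kap * tdist1 𝔇.Nf ((𝔇.𝒦 Z t).locΛ b) ((𝔇.𝒦 Z t).locN j)))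
  hCs : ∀ σ : TPt P.d (domCount P M (k + 1)) → ℂ, (∀ j, ‖σ j‖ ≤ Real.exp c.κ₁) →
      ∀ b b', ‖(𝔇.A Z t φ σ)⁻¹ b b'‖ ≤ KCs * Real.exp (-(kap * tdist1 𝔇.Nf ((𝔇.𝒦 Z t).locΛ b) ((𝔇.𝒦 Z t).locΛ b')))
  hC216 : ∀ b b', ‖(𝔇.𝒦 Z t).C b b'‖ ≤ K₀ * Real.exp (-(kap * tdist1 𝔇.Nf ((𝔇.𝒦 Z t).locΛ b) ((𝔇.𝒦 Z t).locΛ b')))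
  -- (L16a) for the kernels at the configuration, in the torus distance
  hdΓ : ∀ σ : TPt P.d (domCount P M (k + 1)) → ℂ, (∀ j, ‖σ j‖ ≤ Real.exp c.κ₁) →
      ∀ b j, ‖((𝔇.𝒦 Z t).G2 σ (𝔇.uOf Z t φ) - (𝔇.𝒦 Z t).Γ₀.map (algebraMap ℝ ℂ)) b j‖
      ≤ θΓ * Real.exp (-(kap * tdist1 𝔇.Nf ((𝔇.𝒦 Z t).locΛ b) ((𝔇.𝒦 Z t).locN j)))
  hdC : ∀ σ : TPt P.d (domCount P M (k + 1)) → ℂ, (∀ j, ‖σ j‖ ≤ Real.exp c.κ₁) →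
      ∀ b b', ‖((𝔇.A Z t φ σ)⁻¹ - (𝔇.𝒦 Z t).C.map (algebraMap ℝ ℂ)) b b'‖
      ≤ θC * Real.exp (-(kap * tdist1 𝔇.Nf ((𝔇.𝒦 Z t).locΛ b) ((𝔇.𝒦 Z t).locΛ b')))
  hdE : ∀ σ : TPt P.d (domCount P M (k + 1)) → ℂ, (∀ j, ‖σ j‖ ≤ Real.exp c.κ₁) →
      ∀ b b', ‖(𝔇.A Z t φ σ - (𝔇.𝒦 Z t).C⁻¹.map (algebraMap ℝ ℂ)) b b'‖
      ≤ θE * Real.exp (-(kap * tdist1 𝔇.Nf ((𝔇.𝒦 Z t).locΛ b) ((𝔇.𝒦 Z t).locΛ b')))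
  hsmallKθ : K₀ * ((𝔇.𝒦 Z t).m * (1 + 2 / kap) ^ 𝔇.ν) * (θ * ((𝔇.𝒦 Z t).m * (1 + 2 / kap'') ^ 𝔇.ν)) < 1
  -- the (2.24)–(2.25) smallness
  cE : ℝ
  g : ℝ
  hc0 : 0 ≤ cE
  hc : ∀ i, (𝔇.𝒦 Z t).hC.1.eigenvalues i ≤ cE
  hαc : (2 * (θ * ((𝔇.𝒦 Z t).m * (1 + 2 / kap'') ^ 𝔇.ν)) + (γ₂ + a₂₀)) * cE ≤ 1 / 2
  hg : 0 ≤ g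
  hΓq : ∀ X : (𝔇.𝒦 Z t).Λ ⊕ (𝔇.𝒦 Z t).C₀ → ℝ,
      ((𝔇.𝒦 Z t).Γ₀ *ᵥ X) ⬝ᵥ ((𝔇.𝒦 Z t).C *ᵥ ((𝔇.𝒦 Z t).Γ₀ *ᵥ X)) ≤ g * (X ⬝ᵥ X)
  hsmall : (2 * (θ * ((𝔇.𝒦 Z t).m * (1 + 2 / kap'') ^ 𝔇.ν)) + (γ₂ + a₂₀)) * (1 + 2 * cE * g) ≤ 1 / 2
  -- constant matching, p. 17
  hPa : a ≤ γ₂ * rP ^ 2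
  hvol : 2 * (K₀ * ((𝔇.𝒦 Z t).m * (1 + 2 / kap) ^ 𝔇.ν) * (θ * ((𝔇.𝒦 Z t).m * (1 + 2 / kap'') ^ 𝔇.ν))
      * (1 + (1 - K₀ * ((𝔇.𝒦 Z t).m * (1 + 2 / kap) ^ 𝔇.ν) * (θ * ((𝔇.𝒦 Z t).m * (1 + 2 / kap'') ^ 𝔇.ν)))⁻¹) / 2)
      * (Fintype.card (𝔇.𝒦 Z t).Λ : ℝ)
      + w + (2 * (θ * ((𝔇.𝒦 Z t).m * (1 + 2 / kap'') ^ 𝔇.ν)) + (γ₂ + a₂₀)) * cE * (Fintype.card (𝔇.𝒦 Z t).Λ : ℝ)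
      + (2 * (θ * ((𝔇.𝒦 Z t).m * (1 + 2 / kap'') ^ 𝔇.ν)) + (γ₂ + a₂₀)) * (1 + 2 * cE * g)
      * (Fintype.card ((𝔇.𝒦 Z t).Λ ⊕ (𝔇.𝒦 Z t).C₀) : ℝ)
      ≤ a₅ * ((Z.1).card : ℝ)

/-- **THE LOCATED (2.26) INPUTS HOLD** (propositional shadow of `Inputs226`, the shape a per-term schema quantifies: «`∀ z ∈ D,
𝔇.PrimitiveInputs226 Z t s (cv z) φ a a₅`»). [cite: Balaban1988RG2Cluster, (2.14)-(2.26) pp.15-17] -/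
def PrimitiveInputs226 (Z : (domSys P M (k + 1)).Dom) (t : TermLabel P M k L) (s : ℂ) (old : OlderTerms P 𝔸 M k) (φ : CPair P 𝔸)
    (a a₅ : ℝ) : Prop :=
  Nonempty (𝔇.Inputs226 Z t s old φ a a₅)

variable {𝔇}

/-- **(2.26) FOR THE DATUM's TERM FROM ITS RECORD OF LOCATED INPUTS** — storey 7's `norm_TF_le_weight_of_primitives`, field by field.
[cite: Balaban1988RG2Cluster, (2.26) p.17, (2.14) p.15] -/
theorem Inputs226.norm_TF_le_weight (hκ₁ : 1 ≤ c.κ₁) (hα₆ : c.α₆ ≠ 0)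
    {Z : (domSys P M (k + 1)).Dom} {t : TermLabel P M k L} {s : ℂ} {old : OlderTerms P 𝔸 M k} {φ : CPair P 𝔸} {a a₅ : ℝ}
    (ι : 𝔇.Inputs226 Z t s old φ a a₅) :
    ‖𝔇.TF Z t s old φ‖ ≤ weight L M c Z a t * Real.exp (a₅ * ((Z.1).card : ℝ)) :=
  𝔇.norm_TF_le_weight_of_primitives hκ₁ hα₆ Z t s old φ ι.hpos ι.hhalf ι.hUσ ι.hUτ ι.hUexp ι.hUtau ι.hr ι.hr' ι.hsubτ
    ι.hχ0 ι.hχc0 ι.hΨσ ι.hΨτ ι.hAs ι.hA ι.qP ι.h222 ι.hγ₂ ι.hqP ι.h220R ι.ha0 ι.hfibN ι.hkap'' ι.h1 ι.h2 ι.hθE ι.hθΓ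
    ι.hθC ι.hKG ι.hKΓ ι.hKCs ι.hK₀ ι.hθEle ι.hθΓle ι.hθR1le ι.hG ι.hΓ₀ ι.hCs ι.hC216 ι.hdΓ ι.hdC ι.hdE ι.hsmallKθ
    ι.hc0 ι.hc ι.hαc ι.hg ι.hΓq ι.hsmall ι.hPa ι.hvol

/-- **(2.26) FOR THE DATUM's TERM UNDER `PrimitiveInputs226`** — the socket a per-term schema at `TF := 𝔇.TF` consumes.
[cite: Balaban1988RG2Cluster, (2.26) p.17, (2.14) p.15] -/
theorem norm_TF_le_weight_of_inputs226 (hκ₁ : 1 ≤ c.κ₁) (hα₆ : c.α₆ ≠ 0)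
    {Z : (domSys P M (k + 1)).Dom} {t : TermLabel P M k L} {s : ℂ} {old : OlderTerms P 𝔸 M k} {φ : CPair P 𝔸} {a a₅ : ℝ}
    (h : 𝔇.PrimitiveInputs226 Z t s old φ a a₅) :
    ‖𝔇.TF Z t s old φ‖ ≤ weight L M c Z a t * Real.exp (a₅ * ((Z.1).card : ℝ)) :=
  h.elim fun ι => ι.norm_TF_le_weight hκ₁ hα₆

/-- **Weakening the weight letters**: the located inputs for `(a, a₅)` are located inputs for any `a′ ≤ a` (a weaker `|P|`-rate) and `a₅′ ≥ a₅`
(a bigger «O(1)α₅»). [cite: Balaban1988RG2Cluster, (2.26) p.17] -/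
def Inputs226.weaken {Z : (domSys P M (k + 1)).Dom} {t : TermLabel P M k L} {s : ℂ} {old : OlderTerms P 𝔸 M k} {φ : CPair P 𝔸}
    {a a₅ a' a₅' : ℝ} (ha : a' ≤ a) (h₅ : a₅ ≤ a₅') (ι : 𝔇.Inputs226 Z t s old φ a a₅) : 𝔇.Inputs226 Z t s old φ a' a₅' :=
  { ι with
    hPa := ha.trans ι.hPa
    hvol := ι.hvol.trans (mul_le_mul_of_nonneg_right h₅ (Nat.cast_nonneg _)) }

/-- `PrimitiveInputs226` is antitone in `a` and monotone in `a₅`. [cite: Balaban1988RG2Cluster, (2.26) p.17] -/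
theorem PrimitiveInputs226.weaken {Z : (domSys P M (k + 1)).Dom} {t : TermLabel P M k L} {s : ℂ} {old : OlderTerms P 𝔸 M k}
    {φ : CPair P 𝔸} {a a₅ a' a₅' : ℝ} (ha : a' ≤ a) (h₅ : a₅ ≤ a₅') (h : 𝔇.PrimitiveInputs226 Z t s old φ a a₅) :
    𝔇.PrimitiveInputs226 Z t s old φ a' a₅' :=
  h.elim fun ι => ⟨ι.weaken ha h₅⟩

end Inputs

/-! ## §2  (2.26) at the datum WITHOUT `hΨσ ∕ hΨτ`, at print's per-domain τ-radii — `h226_torus_of_primitives_holo_polyτ` by name -/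

section Holo

variable {c₀ : B13.Consts} {P : Params} {𝔸 : Type*} {M k L : ℕ} [NeZero L] (𝔇 : TermDatum214 c₀ P 𝔸 M k L)

open Classical in
/-- **(2.26) FOR THE DATUM's TERM FROM THE LOCATED PRIMITIVE INPUTS, KERNEL-KEYED, WITHOUT THE REGULARITY LETTERS `hΨσ ∕ hΨτ`, AT PRINT's
PER-DOMAIN τ-RADII** — `B13Lemma3TorusPrimitivePoly.h226_torus_of_primitives_holo_polyτ` for the term `𝔇.TF Z t s old φ` = `term214 r (Z∖Z′₀) 𝐃
(core214 A Γ (F214 |P| χ χᶜ 𝐃 𝒱)) 0 0`, with the Γ-kernel `G(σ) := (𝒦 Z t).G2 σ (uOf φ)`, the references `Γ₀ := (𝒦 Z t).Γ₀`, `C := (𝒦 Z t).C ≻ 0`,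
the locations and the row fibre bound READ OFF NODE A's kernel record, and the list ∕ linearity binders discharged.  Compared with storey 7's
`norm_TF_le_weight_of_primitives`: the estimate's constants record `c` is a binder; per-domain τ-regions `Uτ Y`; NO separate-analyticity
hypotheses — instead entrywise σ-holomorphy of `A(σ, uOf φ)`, `G(σ, uOf φ)` on the open σ-polydisc `{σ | ∀ j, σ j ∈ Uσ}`, measurability of
`χ_{k,Y₀}(s,·)`, `χᶜ_{k,P}(s,·)`, `𝐕_k(Y,·)`, and (2.20) on `Π_Y Uτ Y` (`h220U`); the σ-letters on the open σ-polydisc.  Same conclusion, same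
constants.  One application of the tree theorem; no estimate proved here.
[cite: Balaban1988RG2Cluster, (2.14)-(2.15) p.15, (2.16)-(2.22) p.16, (2.23)-(2.26) p.17, Lemma 2 p.11] -/
theorem norm_TF_le_weight_of_primitives_holo (c : B13.Consts) (hκ₁ : 1 ≤ c.κ₁) (hα₆ : c.α₆ ≠ 0)
    (Z : (domSys P M (k + 1)).Dom) (t : TermLabel P M k L) (s : ℂ) (old : OlderTerms P 𝔸 M k) (φ : CPair P 𝔸)
    (hpos : ∀ Y : TDom P.d (L * domCount P M (k + 1)), 0 < invTau c ((tsys P.d (L * domCount P M (k + 1))).dj Y))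
    (hhalf : ∀ Y : TDom P.d (L * domCount P M (k + 1)), invTau c ((tsys P.d (L * domCount P M (k + 1))).dj Y) ≤ 1 / 2)
    -- the σ-region (one open set ⊇ the closed e^{κ₁}-ball) and the PER-DOMAIN τ-regions (print's radii (2.18))
    {Uσ : Set ℂ} {Uτ : TDom P.d (L * domCount P M (k + 1)) → Set ℂ} (hUσ : IsOpen Uσ) (hUτ : ∀ Y, IsOpen (Uτ Y))
    (hUexp : closedBall (0 : ℂ) (Real.exp c.κ₁) ⊆ Uσ)
    (hUtau : ∀ Y : TDom P.d (L * domCount P M (k + 1)),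
      closedBall (0 : ℂ) ((invTau c ((tsys P.d (L * domCount P M (k + 1))).dj Y))⁻¹) ⊆ Uτ Y)
    (hr : 0 < 𝔇.r) (hr' : 𝔇.r ≤ Real.exp c.κ₁ - 1)
    (hsubτ : ∀ Y, ∀ x ∈ Set.uIcc (0 : ℝ) 1, closedBall (x : ℂ) 𝔇.r ⊆ Uτ Y)
    -- the last line at the coupling: signs of χ, χᶜ
    (hχ0 : ∀ B, 0 ≤ 𝔇.chiY₀ Z t s B) (hχc0 : ∀ B, 0 ≤ 𝔇.chicP Z t s B)
    -- REPLACES the separate analyticity hΨσ ∕ hΨτ: entrywise holomorphy of the kernels A(σ,u), G(σ,u) in σ on the OPEN σ-polydisc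
    -- {σ | ∀ j, σ j ∈ Uσ} (NODE A), measurability of χ, χᶜ and of the potentials in the row-bond field (Lemma 2 ∕ (2.3))
    (hAhol : ∀ i j, DifferentiableOn ℂ (fun σ => 𝔇.A Z t φ σ i j) {σ | ∀ j, σ j ∈ Uσ})
    (hGhol : ∀ i j, DifferentiableOn ℂ (fun σ => (𝔇.𝒦 Z t).G2 σ (𝔇.uOf Z t φ) i j) {σ | ∀ j, σ j ∈ Uσ})
    (hχm : Measurable (𝔇.chiY₀ Z t s)) (hχcm : Measurable (𝔇.chicP Z t s)) (hVm : ∀ Y, Measurable (𝔇.𝒱 Z t s old φ Y))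
    -- NODE A: symmetry and `Re ≻ 0` of the precision at (σ, u), on the open σ-polydisc
    (hAs : ∀ σ : TPt P.d (domCount P M (k + 1)) → ℂ, (∀ j, σ j ∈ Uσ) → (𝔇.A Z t φ σ).IsSymm)
    (hA : ∀ σ : TPt P.d (domCount P M (k + 1)) → ℂ, (∀ j, σ j ∈ Uσ) → ((𝔇.A Z t φ σ).map Complex.re).PosDef)
    -- the (2.22) and (2.20) shapes
    {γ₂ rP a₂₀ w : ℝ} (qP : ((𝔇.𝒦 Z t).Λ → ℝ) → ℝ)
    (h222 : ∀ B, 𝔇.chiY₀ Z t s B * 𝔇.chicP Z t s B ≤ Real.exp (-(γ₂ / 2 * rP ^ 2 * (t.2.card : ℕ)) + γ₂ / 2 * qP B)) (hγ₂ : 0 ≤ γ₂)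
    (hqP : ∀ B, qP B ≤ B ⬝ᵥ B)
    -- (2.20) on the open PER-DOMAIN τ-region Π_Y Uτ Y (contains the radii point of the tree's `h220R`)
    (h220U : ∀ τ : TDom P.d (L * domCount P M (k + 1)) → ℂ, (∀ Y, τ Y ∈ Uτ Y) →
      ∀ B, ∑ Y ∈ t.1, ‖τ Y‖ * ‖𝔇.𝒱 Z t s old φ Y B‖ ≤ a₂₀ / 2 * (B ⬝ᵥ B) + w)
    (ha0 : 0 ≤ a₂₀)
    -- the column fibre bound (rows: the kernel record's `hfib`)
    (hfibN : ∀ x : UT 𝔇.Nf, (Finset.univ.filter fun j => (𝔇.𝒦 Z t).locN j = x).card ≤ (𝔇.𝒦 Z t).m)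
    -- rates and constants
    {kap kap' kap'' θ θE θΓ θC KG KΓ KCs K₀ : ℝ} (hkap'' : 0 < kap'') (h1 : kap'' < kap') (h2 : kap' < kap)
    (hθE : 0 ≤ θE) (hθΓ : 0 ≤ θΓ) (hθC : 0 ≤ θC) (hKG : 0 ≤ KG) (hKΓ : 0 ≤ KΓ) (hKCs : 0 ≤ KCs) (hK₀ : 0 ≤ K₀)
    (hθEle : θE ≤ θ) (hθΓle : θΓ ≤ θ)
    (hθR1le : ((𝔇.𝒦 Z t).m * (1 + 2 / (kap - kap')) ^ 𝔇.ν) * ((𝔇.𝒦 Z t).m * (1 + 2 / (kap' - kap'')) ^ 𝔇.ν)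
      * (θΓ * KCs * KG + KΓ * θC * KG + KΓ * K₀ * θΓ) ≤ θ)
    -- (L17a) for the kernels at the configuration, in the torus distance
    (hG : ∀ σ : TPt P.d (domCount P M (k + 1)) → ℂ, (∀ j, σ j ∈ Uσ) →
      ∀ b j, ‖(𝔇.𝒦 Z t).G2 σ (𝔇.uOf Z t φ) b j‖ ≤ KG * Real.exp (-(kap * tdist1 𝔇.Nf ((𝔇.𝒦 Z t).locΛ b) ((𝔇.𝒦 Z t).locN j))))
    (hΓ₀ : ∀ b j, ‖(𝔇.𝒦 Z t).Γ₀ b j‖ ≤ KΓ * Real.exp (-(kap * tdist1 𝔇.Nf ((𝔇.𝒦 Z t).locΛ b) ((𝔇.𝒦 Z t).locN j))))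
    (hCs : ∀ σ : TPt P.d (domCount P M (k + 1)) → ℂ, (∀ j, σ j ∈ Uσ) →
      ∀ b b', ‖(𝔇.A Z t φ σ)⁻¹ b b'‖ ≤ KCs * Real.exp (-(kap * tdist1 𝔇.Nf ((𝔇.𝒦 Z t).locΛ b) ((𝔇.𝒦 Z t).locΛ b'))))
    (hC216 : ∀ b b', ‖(𝔇.𝒦 Z t).C b b'‖ ≤ K₀ * Real.exp (-(kap * tdist1 𝔇.Nf ((𝔇.𝒦 Z t).locΛ b) ((𝔇.𝒦 Z t).locΛ b'))))
    -- (L16a) for the kernels at the configuration, in the torus distance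
    (hdΓ : ∀ σ : TPt P.d (domCount P M (k + 1)) → ℂ, (∀ j, σ j ∈ Uσ) →
      ∀ b j, ‖((𝔇.𝒦 Z t).G2 σ (𝔇.uOf Z t φ) - (𝔇.𝒦 Z t).Γ₀.map (algebraMap ℝ ℂ)) b j‖
        ≤ θΓ * Real.exp (-(kap * tdist1 𝔇.Nf ((𝔇.𝒦 Z t).locΛ b) ((𝔇.𝒦 Z t).locN j))))
    (hdC : ∀ σ : TPt P.d (domCount P M (k + 1)) → ℂ, (∀ j, σ j ∈ Uσ) →
      ∀ b b', ‖((𝔇.A Z t φ σ)⁻¹ - (𝔇.𝒦 Z t).C.map (algebraMap ℝ ℂ)) b b'‖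
        ≤ θC * Real.exp (-(kap * tdist1 𝔇.Nf ((𝔇.𝒦 Z t).locΛ b) ((𝔇.𝒦 Z t).locΛ b'))))
    (hdE : ∀ σ : TPt P.d (domCount P M (k + 1)) → ℂ, (∀ j, σ j ∈ Uσ) →
      ∀ b b', ‖(𝔇.A Z t φ σ - (𝔇.𝒦 Z t).C⁻¹.map (algebraMap ℝ ℂ)) b b'‖
        ≤ θE * Real.exp (-(kap * tdist1 𝔇.Nf ((𝔇.𝒦 Z t).locΛ b) ((𝔇.𝒦 Z t).locΛ b'))))
    (hsmallKθ : K₀ * ((𝔇.𝒦 Z t).m * (1 + 2 / kap) ^ 𝔇.ν) * (θ * ((𝔇.𝒦 Z t).m * (1 + 2 / kap'') ^ 𝔇.ν)) < 1)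
    -- the (2.24)–(2.25) smallness
    {cE g : ℝ} (hc0 : 0 ≤ cE) (hc : ∀ i, (𝔇.𝒦 Z t).hC.1.eigenvalues i ≤ cE)
    (hαc : (2 * (θ * ((𝔇.𝒦 Z t).m * (1 + 2 / kap'') ^ 𝔇.ν)) + (γ₂ + a₂₀)) * cE ≤ 1 / 2) (hg : 0 ≤ g)
    (hΓq : ∀ X : (𝔇.𝒦 Z t).Λ ⊕ (𝔇.𝒦 Z t).C₀ → ℝ,
      ((𝔇.𝒦 Z t).Γ₀ *ᵥ X) ⬝ᵥ ((𝔇.𝒦 Z t).C *ᵥ ((𝔇.𝒦 Z t).Γ₀ *ᵥ X)) ≤ g * (X ⬝ᵥ X))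
    (hsmall : (2 * (θ * ((𝔇.𝒦 Z t).m * (1 + 2 / kap'') ^ 𝔇.ν)) + (γ₂ + a₂₀)) * (1 + 2 * cE * g) ≤ 1 / 2)
    -- constant matching, p. 17
    {a a₅ : ℝ} (hPa : a ≤ γ₂ * rP ^ 2)
    (hvol : 2 * (K₀ * ((𝔇.𝒦 Z t).m * (1 + 2 / kap) ^ 𝔇.ν) * (θ * ((𝔇.𝒦 Z t).m * (1 + 2 / kap'') ^ 𝔇.ν))
              * (1 + (1 - K₀ * ((𝔇.𝒦 Z t).m * (1 + 2 / kap) ^ 𝔇.ν) * (θ * ((𝔇.𝒦 Z t).m * (1 + 2 / kap'') ^ 𝔇.ν)))⁻¹) / 2)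
          * (Fintype.card (𝔇.𝒦 Z t).Λ : ℝ)
        + w + (2 * (θ * ((𝔇.𝒦 Z t).m * (1 + 2 / kap'') ^ 𝔇.ν)) + (γ₂ + a₂₀)) * cE * (Fintype.card (𝔇.𝒦 Z t).Λ : ℝ)
        + (2 * (θ * ((𝔇.𝒦 Z t).m * (1 + 2 / kap'') ^ 𝔇.ν)) + (γ₂ + a₂₀)) * (1 + 2 * cE * g)
          * (Fintype.card ((𝔇.𝒦 Z t).Λ ⊕ (𝔇.𝒦 Z t).C₀) : ℝ)
        ≤ a₅ * ((Z.1).card : ℝ)) :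
    ‖𝔇.TF Z t s old φ‖ ≤ weight L M c Z a t * Real.exp (a₅ * ((Z.1).card : ℝ)) :=
  h226_torus_of_primitives_holo_polyτ c hκ₁ hα₆ Z t hpos hhalf hUσ hUτ hUexp hUtau hr hr' hsubτ
    (sigmaList L Z t) (sigmaList_spec Z t) (tauList P M k L t) (tauList_spec t)
    (𝔇.A Z t φ) (𝔇.Gam Z t φ) (𝔇.chiY₀ Z t s) (𝔇.chicP Z t s) hχ0 hχc0 t.1 (𝔇.𝒱 Z t s old φ)
    (𝔇.𝒦 Z t).hC (𝔇.𝒦 Z t).Γ₀ hAhol hχm hχcm hVm hAs hA (fun σ => (𝔇.𝒦 Z t).G2 σ (𝔇.uOf Z t φ)) hGhol (fun _ _ _ => rfl)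
    qP h222 hγ₂ hqP ha0 h220U (𝔇.𝒦 Z t).locΛ (𝔇.𝒦 Z t).locN (𝔇.𝒦 Z t).hfib hfibN
    hkap'' h1 h2 hθE hθΓ hθC hKG hKΓ hKCs hK₀ hθEle hθΓle hθR1le hG hΓ₀ hCs hC216 hdΓ hdC hdE hsmallKθ hc0 hc hαc hg hΓq hsmall hPa hvol

/-! ## §3  The located inputs of §2's socket as ONE record, and the socket keyed on it -/

open Classical in
/-- **THE LOCATED (2.26) INPUTS OF THE TERM, `hΨσ ∕ hΨτ`-FREE, AT PRINT's PER-DOMAIN τ-RADII, FOR THE ESTIMATE's CONSTANTS RECORD `c`** — the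
binders of §2's socket `norm_TF_le_weight_of_primitives_holo` after the pins `(Z t s old φ)`, verbatim, as the fields of one Type-valued record
(data: the σ-region `Uσ`, the per-domain τ-regions `Uτ : TDom → Set ℂ`, `qP`, the real letters; propositions: as in `Inputs226` except that
separate analyticity is REPLACED by entrywise σ-holomorphy of `A(σ, uOf φ)`, `G(σ, uOf φ)` on the open σ-polydisc, measurability of
`χ_{k,Y₀}(s,·)`, `χᶜ_{k,P}(s,·)`, `𝐕_k(Y,·)`, the σ-letters live on the open σ-polydisc, and (2.20) is `h220U` on `Π_Y Uτ Y`).  A LIST OF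
HYPOTHESES; nothing asserted. [cite: Balaban1988RG2Cluster, (2.14)-(2.15) p.15, (2.16)-(2.22) p.16, (2.23)-(2.26) p.17, Lemma 2 p.11] -/
structure Inputs226Holo (c : B13.Consts) (Z : (domSys P M (k + 1)).Dom) (t : TermLabel P M k L) (s : ℂ) (old : OlderTerms P 𝔸 M k)
    (φ : CPair P 𝔸) (a a₅ : ℝ) where
  hpos : ∀ Y : TDom P.d (L * domCount P M (k + 1)), 0 < invTau c ((tsys P.d (L * domCount P M (k + 1))).dj Y)
  hhalf : ∀ Y : TDom P.d (L * domCount P M (k + 1)), invTau c ((tsys P.d (L * domCount P M (k + 1))).dj Y) ≤ 1 / 2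
  -- the σ-region (one open set ⊇ the closed e^{κ₁}-ball) and the PER-DOMAIN τ-regions (print's radii (2.18))
  Uσ : Set ℂ
  Uτ : TDom P.d (L * domCount P M (k + 1)) → Set ℂ
  hUσ : IsOpen Uσ
  hUτ : ∀ Y, IsOpen (Uτ Y)
  hUexp : closedBall (0 : ℂ) (Real.exp c.κ₁) ⊆ Uσ
  hUtau : ∀ Y : TDom P.d (L * domCount P M (k + 1)),
      closedBall (0 : ℂ) ((invTau c ((tsys P.d (L * domCount P M (k + 1))).dj Y))⁻¹) ⊆ Uτ Y
  hr : 0 < 𝔇.r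
  hr' : 𝔇.r ≤ Real.exp c.κ₁ - 1
  hsubτ : ∀ Y, ∀ x ∈ Set.uIcc (0 : ℝ) 1, closedBall (x : ℂ) 𝔇.r ⊆ Uτ Y
  -- the last line at the coupling: signs of χ, χᶜ
  hχ0 : ∀ B, 0 ≤ 𝔇.chiY₀ Z t s B
  hχc0 : ∀ B, 0 ≤ 𝔇.chicP Z t s B
  -- REPLACES the separate analyticity hΨσ ∕ hΨτ: entrywise holomorphy of the kernels A(σ,u), G(σ,u) in σ on the OPEN σ-polydisc
  -- {σ | ∀ j, σ j ∈ Uσ} (NODE A), measurability of χ, χᶜ and of the potentials in the row-bond field (Lemma 2 ∕ (2.3))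
  hAhol : ∀ i j, DifferentiableOn ℂ (fun σ => 𝔇.A Z t φ σ i j) {σ | ∀ j, σ j ∈ Uσ}
  hGhol : ∀ i j, DifferentiableOn ℂ (fun σ => (𝔇.𝒦 Z t).G2 σ (𝔇.uOf Z t φ) i j) {σ | ∀ j, σ j ∈ Uσ}
  hχm : Measurable (𝔇.chiY₀ Z t s)
  hχcm : Measurable (𝔇.chicP Z t s)
  hVm : ∀ Y, Measurable (𝔇.𝒱 Z t s old φ Y)
  -- NODE A: symmetry and `Re ≻ 0` of the precision at (σ, u), on the open σ-polydisc
  hAs : ∀ σ : TPt P.d (domCount P M (k + 1)) → ℂ, (∀ j, σ j ∈ Uσ) → (𝔇.A Z t φ σ).IsSymm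
  hA : ∀ σ : TPt P.d (domCount P M (k + 1)) → ℂ, (∀ j, σ j ∈ Uσ) → ((𝔇.A Z t φ σ).map Complex.re).PosDef
  -- the (2.22) and (2.20) shapes
  γ₂ : ℝ
  rP : ℝ
  a₂₀ : ℝ
  w : ℝ
  qP : ((𝔇.𝒦 Z t).Λ → ℝ) → ℝ
  h222 : ∀ B, 𝔇.chiY₀ Z t s B * 𝔇.chicP Z t s B ≤ Real.exp (-(γ₂ / 2 * rP ^ 2 * (t.2.card : ℕ)) + γ₂ / 2 * qP B)
  hγ₂ : 0 ≤ γ₂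
  hqP : ∀ B, qP B ≤ B ⬝ᵥ B
  -- (2.20) on the open PER-DOMAIN τ-region Π_Y Uτ Y (contains the radii point of the tree's `h220R`)
  h220U : ∀ τ : TDom P.d (L * domCount P M (k + 1)) → ℂ, (∀ Y, τ Y ∈ Uτ Y) →
      ∀ B, ∑ Y ∈ t.1, ‖τ Y‖ * ‖𝔇.𝒱 Z t s old φ Y B‖ ≤ a₂₀ / 2 * (B ⬝ᵥ B) + w
  ha0 : 0 ≤ a₂₀
  -- the column fibre bound (rows: the kernel record's `hfib`)
  hfibN : ∀ x : UT 𝔇.Nf, (Finset.univ.filter fun j => (𝔇.𝒦 Z t).locN j = x).card ≤ (𝔇.𝒦 Z t).m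
  -- rates and constants
  kap : ℝ
  kap' : ℝ
  kap'' : ℝ
  θ : ℝ
  θE : ℝ
  θΓ : ℝ
  θC : ℝ
  KG : ℝ
  KΓ : ℝ
  KCs : ℝ
  K₀ : ℝ
  hkap'' : 0 < kap''
  h1 : kap'' < kap'
  h2 : kap' < kap
  hθE : 0 ≤ θE
  hθΓ : 0 ≤ θΓ
  hθC : 0 ≤ θC
  hKG : 0 ≤ KG
  hKΓ : 0 ≤ KΓ
  hKCs : 0 ≤ KCs
  hK₀ : 0 ≤ K₀
  hθEle : θE ≤ θ
  hθΓle : θΓ ≤ θ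
  hθR1le : ((𝔇.𝒦 Z t).m * (1 + 2 / (kap - kap')) ^ 𝔇.ν) * ((𝔇.𝒦 Z t).m * (1 + 2 / (kap' - kap'')) ^ 𝔇.ν)
      * (θΓ * KCs * KG + KΓ * θC * KG + KΓ * K₀ * θΓ) ≤ θ
  -- (L17a) for the kernels at the configuration, in the torus distance
  hG : ∀ σ : TPt P.d (domCount P M (k + 1)) → ℂ, (∀ j, σ j ∈ Uσ) →
      ∀ b j, ‖(𝔇.𝒦 Z t).G2 σ (𝔇.uOf Z t φ) b j‖ ≤ KG * Real.exp (-(kap * tdist1 𝔇.Nf ((𝔇.𝒦 Z t).locΛ b) ((𝔇.𝒦 Z t).locN j)))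
  hΓ₀ : ∀ b j, ‖(𝔇.𝒦 Z t).Γ₀ b j‖ ≤ KΓ * Real.exp (-(kap * tdist1 𝔇.Nf ((𝔇.𝒦 Z t).locΛ b) ((𝔇.𝒦 Z t).locN j)))
  hCs : ∀ σ : TPt P.d (domCount P M (k + 1)) → ℂ, (∀ j, σ j ∈ Uσ) →
      ∀ b b', ‖(𝔇.A Z t φ σ)⁻¹ b b'‖ ≤ KCs * Real.exp (-(kap * tdist1 𝔇.Nf ((𝔇.𝒦 Z t).locΛ b) ((𝔇.𝒦 Z t).locΛ b')))
  hC216 : ∀ b b', ‖(𝔇.𝒦 Z t).C b b'‖ ≤ K₀ * Real.exp (-(kap * tdist1 𝔇.Nf ((𝔇.𝒦 Z t).locΛ b) ((𝔇.𝒦 Z t).locΛ b')))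
  -- (L16a) for the kernels at the configuration, in the torus distance
  hdΓ : ∀ σ : TPt P.d (domCount P M (k + 1)) → ℂ, (∀ j, σ j ∈ Uσ) →
      ∀ b j, ‖((𝔇.𝒦 Z t).G2 σ (𝔇.uOf Z t φ) - (𝔇.𝒦 Z t).Γ₀.map (algebraMap ℝ ℂ)) b j‖
      ≤ θΓ * Real.exp (-(kap * tdist1 𝔇.Nf ((𝔇.𝒦 Z t).locΛ b) ((𝔇.𝒦 Z t).locN j)))
  hdC : ∀ σ : TPt P.d (domCount P M (k + 1)) → ℂ, (∀ j, σ j ∈ Uσ) →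
      ∀ b b', ‖((𝔇.A Z t φ σ)⁻¹ - (𝔇.𝒦 Z t).C.map (algebraMap ℝ ℂ)) b b'‖
      ≤ θC * Real.exp (-(kap * tdist1 𝔇.Nf ((𝔇.𝒦 Z t).locΛ b) ((𝔇.𝒦 Z t).locΛ b')))
  hdE : ∀ σ : TPt P.d (domCount P M (k + 1)) → ℂ, (∀ j, σ j ∈ Uσ) →
      ∀ b b', ‖(𝔇.A Z t φ σ - (𝔇.𝒦 Z t).C⁻¹.map (algebraMap ℝ ℂ)) b b'‖
      ≤ θE * Real.exp (-(kap * tdist1 𝔇.Nf ((𝔇.𝒦 Z t).locΛ b) ((𝔇.𝒦 Z t).locΛ b')))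
  hsmallKθ : K₀ * ((𝔇.𝒦 Z t).m * (1 + 2 / kap) ^ 𝔇.ν) * (θ * ((𝔇.𝒦 Z t).m * (1 + 2 / kap'') ^ 𝔇.ν)) < 1
  -- the (2.24)–(2.25) smallness
  cE : ℝ
  g : ℝ
  hc0 : 0 ≤ cE
  hc : ∀ i, (𝔇.𝒦 Z t).hC.1.eigenvalues i ≤ cE
  hαc : (2 * (θ * ((𝔇.𝒦 Z t).m * (1 + 2 / kap'') ^ 𝔇.ν)) + (γ₂ + a₂₀)) * cE ≤ 1 / 2
  hg : 0 ≤ g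
  hΓq : ∀ X : (𝔇.𝒦 Z t).Λ ⊕ (𝔇.𝒦 Z t).C₀ → ℝ,
      ((𝔇.𝒦 Z t).Γ₀ *ᵥ X) ⬝ᵥ ((𝔇.𝒦 Z t).C *ᵥ ((𝔇.𝒦 Z t).Γ₀ *ᵥ X)) ≤ g * (X ⬝ᵥ X)
  hsmall : (2 * (θ * ((𝔇.𝒦 Z t).m * (1 + 2 / kap'') ^ 𝔇.ν)) + (γ₂ + a₂₀)) * (1 + 2 * cE * g) ≤ 1 / 2
  -- constant matching, p. 17
  hPa : a ≤ γ₂ * rP ^ 2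
  hvol : 2 * (K₀ * ((𝔇.𝒦 Z t).m * (1 + 2 / kap) ^ 𝔇.ν) * (θ * ((𝔇.𝒦 Z t).m * (1 + 2 / kap'') ^ 𝔇.ν))
      * (1 + (1 - K₀ * ((𝔇.𝒦 Z t).m * (1 + 2 / kap) ^ 𝔇.ν) * (θ * ((𝔇.𝒦 Z t).m * (1 + 2 / kap'') ^ 𝔇.ν)))⁻¹) / 2)
      * (Fintype.card (𝔇.𝒦 Z t).Λ : ℝ)
      + w + (2 * (θ * ((𝔇.𝒦 Z t).m * (1 + 2 / kap'') ^ 𝔇.ν)) + (γ₂ + a₂₀)) * cE * (Fintype.card (𝔇.𝒦 Z t).Λ : ℝ)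
      + (2 * (θ * ((𝔇.𝒦 Z t).m * (1 + 2 / kap'') ^ 𝔇.ν)) + (γ₂ + a₂₀)) * (1 + 2 * cE * g)
      * (Fintype.card ((𝔇.𝒦 Z t).Λ ⊕ (𝔇.𝒦 Z t).C₀) : ℝ)
      ≤ a₅ * ((Z.1).card : ℝ)

/-- **THE `hΨσ ∕ hΨτ`-FREE LOCATED (2.26) INPUTS HOLD** (propositional shadow of `Inputs226Holo`).
[cite: Balaban1988RG2Cluster, (2.14)-(2.26) pp.15-17] -/
def PrimitiveInputs226Holo (c : B13.Consts) (Z : (domSys P M (k + 1)).Dom) (t : TermLabel P M k L) (s : ℂ) (old : OlderTerms P 𝔸 M k)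
    (φ : CPair P 𝔸) (a a₅ : ℝ) : Prop :=
  Nonempty (𝔇.Inputs226Holo c Z t s old φ a a₅)

variable {𝔇}

/-- **(2.26) FOR THE DATUM's TERM FROM ITS `hΨσ ∕ hΨτ`-FREE RECORD OF LOCATED INPUTS** — §2's `norm_TF_le_weight_of_primitives_holo`, field by
field. [cite: Balaban1988RG2Cluster, (2.26) p.17, (2.14) p.15] -/
theorem Inputs226Holo.norm_TF_le_weight {c : B13.Consts} (hκ₁ : 1 ≤ c.κ₁) (hα₆ : c.α₆ ≠ 0)
    {Z : (domSys P M (k + 1)).Dom} {t : TermLabel P M k L} {s : ℂ} {old : OlderTerms P 𝔸 M k} {φ : CPair P 𝔸} {a a₅ : ℝ}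
    (ι : 𝔇.Inputs226Holo c Z t s old φ a a₅) :
    ‖𝔇.TF Z t s old φ‖ ≤ weight L M c Z a t * Real.exp (a₅ * ((Z.1).card : ℝ)) :=
  𝔇.norm_TF_le_weight_of_primitives_holo c hκ₁ hα₆ Z t s old φ ι.hpos ι.hhalf ι.hUσ ι.hUτ ι.hUexp ι.hUtau ι.hr ι.hr'
    ι.hsubτ ι.hχ0 ι.hχc0 ι.hAhol ι.hGhol ι.hχm ι.hχcm ι.hVm ι.hAs ι.hA ι.qP ι.h222 ι.hγ₂ ι.hqP ι.h220U ι.ha0 ι.hfibN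
    ι.hkap'' ι.h1 ι.h2 ι.hθE ι.hθΓ ι.hθC ι.hKG ι.hKΓ ι.hKCs ι.hK₀ ι.hθEle ι.hθΓle ι.hθR1le ι.hG ι.hΓ₀ ι.hCs ι.hC216
    ι.hdΓ ι.hdC ι.hdE ι.hsmallKθ ι.hc0 ι.hc ι.hαc ι.hg ι.hΓq ι.hsmall ι.hPa ι.hvol

/-- **(2.26) FOR THE DATUM's TERM UNDER `PrimitiveInputs226Holo`.** [cite: Balaban1988RG2Cluster, (2.26) p.17, (2.14) p.15] -/
theorem norm_TF_le_weight_of_inputs226Holo {c : B13.Consts} (hκ₁ : 1 ≤ c.κ₁) (hα₆ : c.α₆ ≠ 0)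
    {Z : (domSys P M (k + 1)).Dom} {t : TermLabel P M k L} {s : ℂ} {old : OlderTerms P 𝔸 M k} {φ : CPair P 𝔸} {a a₅ : ℝ}
    (h : 𝔇.PrimitiveInputs226Holo c Z t s old φ a a₅) :
    ‖𝔇.TF Z t s old φ‖ ≤ weight L M c Z a t * Real.exp (a₅ * ((Z.1).card : ℝ)) :=
  h.elim fun ι => ι.norm_TF_le_weight hκ₁ hα₆

/-- **Weakening the weight letters** (`hΨσ ∕ hΨτ`-free record). [cite: Balaban1988RG2Cluster, (2.26) p.17] -/
def Inputs226Holo.weaken {c : B13.Consts} {Z : (domSys P M (k + 1)).Dom} {t : TermLabel P M k L} {s : ℂ} {old : OlderTerms P 𝔸 M k}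
    {φ : CPair P 𝔸} {a a₅ a' a₅' : ℝ} (ha : a' ≤ a) (h₅ : a₅ ≤ a₅') (ι : 𝔇.Inputs226Holo c Z t s old φ a a₅) :
    𝔇.Inputs226Holo c Z t s old φ a' a₅' :=
  { ι with
    hPa := ha.trans ι.hPa
    hvol := ι.hvol.trans (mul_le_mul_of_nonneg_right h₅ (Nat.cast_nonneg _)) }

/-- `PrimitiveInputs226Holo` is antitone in `a` and monotone in `a₅`. [cite: Balaban1988RG2Cluster, (2.26) p.17] -/
theorem PrimitiveInputs226Holo.weaken {c : B13.Consts} {Z : (domSys P M (k + 1)).Dom} {t : TermLabel P M k L} {s : ℂ}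
    {old : OlderTerms P 𝔸 M k} {φ : CPair P 𝔸} {a a₅ a' a₅' : ℝ} (ha : a' ≤ a) (h₅ : a₅ ≤ a₅')
    (h : 𝔇.PrimitiveInputs226Holo c Z t s old φ a a₅) : 𝔇.PrimitiveInputs226Holo c Z t s old φ a' a₅' :=
  h.elim fun ι => ⟨ι.weaken ha h₅⟩

end Holo

end TermDatum214

end W1

end Literature.MathematicalPhysics.QuantumFieldTheory.Balaban1983to89.Node00

end
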